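import Mathlib
import HarnessLib
import Summits.Langlands.Langlands.Theses.RamifiedCoefficientSeed
import Summits.Langlands.Langlands.Cruxes.ExplicitRamifiedFamily.RetypeOrdinary_RamifiedCoefficientSeed
import Summits.Langlands.Langlands.Theorems.RamifiedCoefficientSeedExplicitRamifiedFamilyStubNotTwistEquivalent
import Summits.Langlands.Langlands.Theorems.RamifiedCoefficientSeedExplicitRamifiedFamilyStubNotEssSelfDual
import Summits.Langlands.Langlands.Theorems.RamifiedCoefficientSeedExplicitRamifiedFamilyStubResidualDuality

/-!
# RESTATEMENT SKETCH R2 (+R1) for crux stmt-Langlands-16778 `ExplicitRamifiedFamily` — item-holder's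
# `verdict: misstated` package (lead continuation c1, 2026-08-17).  NOT installed; elaborates, 0 sorry.

What the statement should say.  The crux AS FILED puts three different things under one unconditional `∃`:
(i) an OPEN explicit-existence problem (an infinite pairwise twist-inequivalent supply of primitive rank-3
regular motives over `ℚ` with a conjugation-ramified coefficient prime over one `p ≥ 11` — no source in print:
AGG 1984, van Geemen–Top 1994/95 + vGKTV 1997 (`E = ℚ(i), ℚ(√-3)`), Ramakrishnan–Wang 2003 ("such a
construction, in special examples, has been known for some time for `n = 3`"), Ito–Koshikawa–Mieda 2018, Porat
2024 — and five crux-ideate cards describing the search programme), (ii) an XL missing CONSTRUCTOR (no term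
`f : ℕ → FramedGaloisRep ℚ (PadicAlgCl p) 3` of geometric origin exists in the tree: no `H²_ét`, no `r_ι(π)`),
and (iii) a conjunct — `IsCrystallineFramed` at the ε-pinned `fontainePstAdicCompletion` — that is, BY THE DESIGN
of the pin (FontaineDpst: "a statement about it is provable exactly when it holds for EVERY datum on `B_dR` with
the clauses"), undecidable in POSITIVE position for every ρ ramified at `p` (kernel-checked adversarial datum:
`Cruxes/ExplicitRamifiedFamily/Disproof.lean` §3).  (iii) is a typing defect with a known repair; (i)+(ii) are an
honest IOU that should be ONE explicit construction item, not the served crux.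

R2 (+R1 inside), checked below:
* `RamifiedSeedFamilyData p` — the HYPOTHETICAL FAMILY as an explicit interface whose fields are exactly what the
  intended geometry delivers: the family `f`; the two one-element Frobenius certificates (pairs / members; birth's
  cut, whose certificate lemmas are landed: p158189, p158260); unramified a.e.; the DATUM-FREE local condition
  ORD-GEN(0,1,2) at `v ∣ p` (R1, the strategist's `OrdGenAt`; decidable, finitely certifiable — good ORDINARY
  reduction; genericity is free by purity); the unitary / Poincaré duality in the form a conjugation-ramified
  prime gives it, (D′) `ν(σ)·tr ρ(σ⁻¹) = s(tr ρ(σ))` with `s` a residually trivial ring endomorphism of `ℚ̄_p`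
  (lever lemma landed: p161017); residual absolute irreducibility over `ℚ(ζ_p)` (big mod-λ monodromy — kept as a
  field: it is the conjunct that carries the "primitive motive" content, Disproof §4); Hodge symmetry `tr c = ±1`.
* `RamifiedSeedFamilyExists` — `∃ p ≥ 11, Nonempty (RamifiedSeedFamilyData p)`: THE CONSTRUCTION ITEM (= (i)+(ii);
  datum-free, hence meaningful and in principle certifiable by computation on an explicit source; never to be
  staffed by a Lean prover before an `H²` / `r_ι` constructor exists; this is where the five Ideas cards belong).
* `explicitRamifiedFamilyOrd_of_data` — the former crux h1 in its R1 typing (`ExplicitRamifiedFamilyOrd`) is a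
  THEOREM of the interface, PROVED here from the three landed stub lemmas: the served crux disappears.
* `closesR2 : RamifiedSeedFamilyExists → AdjointSeedFromDuality → AdjointLiftingGL3Ord → SectorComplement →
  Langlands` — PROVED (via the strategist's `closesOrd`), i.e. the re-typed route still literally decides the
  summit; `AdjointLiftingGL3Ord` is h3 on the ordinary branch (ACCGHLNSTT2023 Thm 6.1.2, `p > n = 3`; needs
  vendoring next to the vendored Thm 6.1.1), and NO pinned clause remains anywhere in positive position.
* Variant R2′ (if the planner wants to keep h3 = `AdjointLiftingGL3` AS TYPED): put the crux's original pinned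
  clause (C) in the interface as a field INSTEAD of `ordGen` — in hypothesis position the pin is harmless
  ("stronger, never weaker") — and conclude `ExplicitRamifiedFamily` itself (`explicitRamifiedFamily_of_data'`
  below, also proved); the price is that `Nonempty` of that interface is again pin-dependent.
* Honest note on (D′): as a FIELD it is what the geometry gives after Chebotarev (Frobenius traces `a_v ∈ E`,
  `a_v` for the dual twist `= c(a_v)`, `s ⊇ c|_{E_λ}` continuous, Frobenii dense); a planner who wants the
  density step inside Lean can weaken the field to the Frobenius-level identity at almost all `v` plus
  continuity of `s`, at the cost of a Chebotarev named fact in the proof of the lemma.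
-/

set_option linter.dupNamespace false

noncomputable section

namespace Summit.Langlands.Langlands.Cruxes.ExplicitRamifiedFamily.RestateR2

open Summit.Langlands.Langlands.Theses.RamifiedCoefficientSeed
open Summit.Langlands.Langlands.Cruxes.ExplicitRamifiedFamily.RetypeOrdinary
open Summit.Langlands.Langlands.Cruxes.ExplicitRamifiedFamily.Birth
open Literature.NumberTheory.GaloisRepresentations
open Filter IsDedekindDomain
open scoped NumberField MatrixGroups

/-- **R2 interface — a RAMIFIED SEED FAMILY at `p`**: a family `f : ℕ → (Γ_ℚ → GL₃(ℚ̄_p))` together with the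
facts its intended geometric source (λ-adic (1,1,1)-eigenpieces of `H²` of surfaces over `ℚ` with a ℚ-rational
automorphism of order `p^k`, good ordinary reduction at `p`, `E = ℚ(ζ_{p^k})`, `λ = (1 − ζ)`) is supposed to
deliver, as FIELDS (hypothesis position).  [cite: VangeemenTop1994, §1] [cite: ItoKoshikawaMieda2018, Prop. 3.7]
[cite: Greenberg1991, §2] [cite: AshGraysonGreen1984, Table I] -/
structure RamifiedSeedFamilyData (p : ℕ) [Fact p.Prime] where
  /-- The family. -/
  f : ℕ → FramedGaloisRep ℚ (PadicAlgCl p) 3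
  /-- One-element twist-inequivalence certificate for every pair (a Frobenius at which the normalised traces
  `a³/d` of two members differ). -/
  pairCert : ∀ m n, m ≠ n → ∃ σ : Field.absoluteGaloisGroup ℚ,
    (f m σ).val.trace ^ 3 * (f n σ).val.det ≠ (f n σ).val.trace ^ 3 * (f m σ).val.det
  /-- One-element non-essential-self-duality certificate for every member (van Geemen–Top's Frobenius test). -/
  memberCert : ∀ n, ∃ σ : Field.absoluteGaloisGroup ℚ,
    ((f n σ).val.trace ^ 2 - ((f n σ).val ^ 2).trace) ^ 3 ≠ 8 * (f n σ).val.trace ^ 3 * (f n σ).val.det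
  /-- Unramified at all but finitely many places (smooth proper source). -/
  unram : ∀ n, ∀ᶠ v : HeightOneSpectrum (𝓞 ℚ) in cofinite, (f n).IsUnramifiedAt v
  /-- ORD-GEN(0,1,2) at every `v ∣ p` (good ORDINARY reduction at `p`; datum-free). -/
  ordGen : ∀ n (v : HeightOneSpectrum (𝓞 ℚ)), ((p : ℕ) : 𝓞 ℚ) ∈ v.asIdeal → OrdGenAt p (f n) v
  /-- The multiplier of the duality (intended `ε⁻²`). -/
  ν : ℕ → FramedGaloisRep ℚ (PadicAlgCl p) 1
  /-- The lift of complex conjugation of `E` along `E_λ` into the inertia of `Gal(ℚ̄_p/ℚ_p)`. -/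
  s : ℕ → (PadicAlgCl p →+* PadicAlgCl p)
  /-- `s` is residually trivial (`c(λ) = λ`, `c ≡ id mod λ`, `E_λ/ℚ_p` totally ramified). -/
  s_residual : ∀ n (x : PadicAlgCl p), ‖x‖ ≤ 1 → ‖s n x - x‖ < 1
  /-- (D′) the unitary / Poincaré duality `ρᶜ ≅ ρ^∨ ⊗ ν` read on traces through `s` (after Chebotarev). -/
  conjDual : ∀ n σ, (ν n σ).val 0 0 * (f n σ⁻¹).val.trace = s n ((f n σ).val.trace)
  /-- (E) big mod-`λ` monodromy: `ρ̄|ℚ(ζ_p)` absolutely irreducible. -/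
  resAbsIrred : ∀ n, ((f n).restrictField (CyclotomicField p ℚ)).IsResiduallyAbsIrreducible
  /-- (F) Hodge symmetry for Hodge numbers (1,1,1): a complex conjugation of trace `±1`. -/
  hodgeSym : ∀ n, ∃ (φ : ℚ →+* ℝ) (c : Field.absoluteGaloisGroup ℚ),
    IsComplexConjugation φ c ∧ (((f n) c).val.trace = 1 ∨ ((f n) c).val.trace = -1)

/-- **R2 h0 — THE CONSTRUCTION ITEM** (the honest IOU: explicit geometry + an `H²`/`r_ι` constructor; open on
paper; never a prover's item before the constructor exists). [cite: VangeemenTop1994, §1] -/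
def RamifiedSeedFamilyExists : Prop :=
  ∃ (p : ℕ) (_ : Fact p.Prime), 11 ≤ p ∧ Nonempty (RamifiedSeedFamilyData p)

/-- **The former crux (R1 typing) is a THEOREM of the interface** — proved from the three landed stub lemmas of
line `birth` (pairs certificate ⇒ PW, member certificate ⇒ (A), lever ⇒ (D)); (B), ORD-GEN, (E), (F) are
fields. [folklore] -/
theorem explicitRamifiedFamilyOrd_of_data {p : ℕ} [hp : Fact p.Prime] (h11 : 11 ≤ p)
    (𝓕 : RamifiedSeedFamilyData p) : ExplicitRamifiedFamilyOrd := by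
  refine ⟨p, hp, h11, 𝓕.f, ?_, fun n => ?_⟩
  · intro m n hmn
    exact stub_not_twistEquivalent_of_certificate p ℚ (𝓕.f m) (𝓕.f n) (𝓕.pairCert m n hmn)
  · exact ⟨stub_not_essSelfDual_of_certificate p ℚ (𝓕.f n) (𝓕.memberCert n), 𝓕.unram n,
      fun v hv => 𝓕.ordGen n v hv,
      ⟨𝓕.ν n, stub_residualDuality_of_conjDuality p ℚ (𝓕.f n) (𝓕.ν n) (𝓕.s n) (𝓕.s_residual n)
        (𝓕.conjDual n)⟩,
      𝓕.resAbsIrred n, 𝓕.hodgeSym n⟩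

/-- … hence from the construction item. [folklore] -/
theorem explicitRamifiedFamilyOrd_of_exists (h : RamifiedSeedFamilyExists) : ExplicitRamifiedFamilyOrd := by
  obtain ⟨p, hp, h11, ⟨𝓕⟩⟩ := h
  exact explicitRamifiedFamilyOrd_of_data h11 𝓕

/-- **R2 deciding theorem**: the construction item, the residual lever (h2 as typed), ordinary lifting (h3 on the
Thm 6.1.2 branch) and the sector complement literally decide the summit — no pinned clause in positive position
anywhere. [cite: ACCGHLNSTT2023, Thm 6.1.2] -/
theorem closesR2 (h0 : RamifiedSeedFamilyExists) (h2 : AdjointSeedFromDuality) (h3 : AdjointLiftingGL3Ord)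
    (h4 : SectorComplement) : _root_.Langlands :=
  closesOrd (explicitRamifiedFamilyOrd_of_exists h0) h2 h3 h4

/-! ### Variant R2′: keep h3 as typed, pin in HYPOTHESIS position -/

/-- **R2′ interface**: as `RamifiedSeedFamilyData` but with the crux's ORIGINAL pinned clause (C) as the local
field (harmless in hypothesis position). [folklore] -/
structure RamifiedSeedFamilyData' (p : ℕ) [Fact p.Prime] extends RamifiedSeedFamilyData p where
  /-- (C) as filed: pinned-crystalline with labelled weights `{0,1,2}` at every `v ∣ p`. -/
  pinnedCrys : ∀ n (v : HeightOneSpectrum (𝓞 ℚ)) (hv : ((p : ℕ) : 𝓞 ℚ) ∈ v.asIdeal),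
    let D := Literature.NumberTheory.PAdicHodge.fontainePstAdicCompletion v p hv
    D.IsCrystallineFramed ((f n).toLocal v) ∧
      (letI := D.algebra
       ∀ τ : v.adicCompletion ℚ →ₐ[ℚ_[p]] PadicAlgCl p,
         (f n).labelledHodgeTateWeightsAt v D.algebra D.𝔅 τ.toRingHom = {0, 1, 2})

/-- **R2′: the crux AS FILED is a theorem of the primed interface.** [folklore] -/
theorem explicitRamifiedFamily_of_data' {p : ℕ} [hp : Fact p.Prime] (h11 : 11 ≤ p)
    (𝓕 : RamifiedSeedFamilyData' p) : ExplicitRamifiedFamily := by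
  refine ⟨p, hp, h11, 𝓕.f, ?_, fun n => ?_⟩
  · intro m n hmn
    exact stub_not_twistEquivalent_of_certificate p ℚ (𝓕.f m) (𝓕.f n) (𝓕.pairCert m n hmn)
  · exact ⟨stub_not_essSelfDual_of_certificate p ℚ (𝓕.f n) (𝓕.memberCert n), 𝓕.unram n,
      fun v hv => 𝓕.pinnedCrys n v hv,
      ⟨𝓕.ν n, stub_residualDuality_of_conjDuality p ℚ (𝓕.f n) (𝓕.ν n) (𝓕.s n) (𝓕.s_residual n)
        (𝓕.conjDual n)⟩,
      𝓕.resAbsIrred n, 𝓕.hodgeSym n⟩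

/-- **R2′ deciding theorem** with h3 AS TYPED. [folklore] -/
theorem closesR2' (h0 : ∃ (p : ℕ) (_ : Fact p.Prime), 11 ≤ p ∧ Nonempty (RamifiedSeedFamilyData' p))
    (h2 : AdjointSeedFromDuality) (h3 : AdjointLiftingGL3) (h4 : SectorComplement) : _root_.Langlands := by
  obtain ⟨p, hp, h11, ⟨𝓕⟩⟩ := h0
  exact closes (explicitRamifiedFamily_of_data' h11 𝓕) h2 h3 h4

end Summit.Langlands.Langlands.Cruxes.ExplicitRamifiedFamily.RestateR2

end
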